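import Mathlib
import Literature.NumberTheory.Transcendental.KZCalculusProofs

/-!
# `OffTetraSectorKernel` (stmt-KontsevichZagierPeriods-10557), line `odd-hyperbolic-ladder`:
# floors have infinite hyperbolic volume (rung 2, floor divergence)

Stub `stub_floorDivergence`. Rung 2 of the hyperbolic scissors ladder consists of the volumes of
finite-volume `ℚ̄`-geodesic polytopes of hyperbolic 3-space (upper half-space model,
`p : Fin 3 → ℝ`, horizontal part `q = (p 0, p 1)`, height `t = p 2 > 0`, volume density `t⁻³`).
In the paraboloid lift `Ql p = (|p|², p 0, p 1, 1)` every geodesic half-space is linear,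
`0 < ∑ c, L i c * Ql p c = gᵢ(q) + L i 0 * t²`, where
`gᵢ(n) = L i 0 * |n|² + L i 1 * n₀ + L i 2 * n₁ + L i 3` is the FLOOR TRACE of the constraint
(`L i 0 = 0`: a vertical plane; `L i 0 ≠ 0`: a hemisphere centred on the boundary plane `t = 0`).
If at a floor point `n` every trace is positive, except possibly one which vanishes with non-zero
gradient, then at a nearby floor point all traces are positive (move off `n` along that gradient),
by continuity all constraints are positive on a sup-metric box around it, so the polytope contains
a box `(square) × (0, ρ)`, and on such a box `∫ t⁻³ = ∞` (Fubini: almost every vertical fibre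
would be integrable, but `∫₀^ρ dt/t³ = ∞`): the density `p ↦ 1 / p 2 ^ 3` is not integrable on the
polytope. This is the rung-2 analogue of `strip_not_integrableOn_of_box` (rung 1).

References: M. Kontsevich, D. Zagier, *Periods* (2001), §1.2.
-/

noncomputable section

open Set MeasureTheory Filter Topology
open Literature.NumberTheory.Transcendental

namespace Summit.KontsevichZagierPeriods.HyperbolicBloch.OffTetraSectorKernel

/-- `t ↦ 1/t³` is not integrable on `(0, δ)` for `δ > 0` (`∫₀ t^s dt < ∞ ↔ -1 < s`). [folklore] -/
theorem floorDiv_not_integrableOn_inv_cube {δ : ℝ} (hδ : 0 < δ) :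
    ¬ IntegrableOn (fun t : ℝ => 1 / t ^ 3) (Ioo 0 δ) := by
  intro h
  have h' : IntegrableOn (fun t : ℝ => t ^ (-3 : ℝ)) (Ioo 0 δ) := by
    refine h.congr_fun (fun t ht => ?_) measurableSet_Ioo
    show 1 / t ^ 3 = t ^ (-3 : ℝ)
    rw [Real.rpow_neg ht.1.le, one_div]
    norm_cast
  have := (intervalIntegral.integrableOn_Ioo_rpow_iff hδ).1 h'
  norm_num at this

/-- FLOORS HAVE INFINITE HYPERBOLIC VOLUME (the divergence lemma): a region of the upper half-space
containing a box `(open square) × (0, δ)` above the boundary plane is not of finite volume for the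
density `t⁻³` — transport `Fin 3 → ℝ` to `ℝ × (Fin 2 → ℝ)` (height first), Fubini: almost every
vertical fibre `t ↦ t⁻³` would be integrable on `(0, δ)`, which is false. [folklore] -/
theorem floorDiv_not_integrableOn_of_box {x y r δ : ℝ} (hr : 0 < r) (hδ : 0 < δ)
    {P : Set (Fin 3 → ℝ)}
    (hP : {p : Fin 3 → ℝ | dist (p 0) x < r ∧ dist (p 1) y < r ∧ 0 < p 2 ∧ p 2 < δ} ⊆ P) :
    ¬ IntegrableOn (fun p : Fin 3 → ℝ => 1 / p 2 ^ 3) P := by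
  intro hint
  have hbox := hint.mono_set hP
  set e := (MeasurableEquiv.piFinSuccAbove (fun _ : Fin 3 => ℝ) 2) with he
  -- the planar open square is a ball of the sup metric of `Fin 2 → ℝ`
  set B : Set (Fin 2 → ℝ) := Metric.ball ![x, y] r with hB
  have hpre : e ⁻¹' (Ioo 0 δ ×ˢ B) =
      {p : Fin 3 → ℝ | dist (p 0) x < r ∧ dist (p 1) y < r ∧ 0 < p 2 ∧ p 2 < δ} := by
    ext p
    have h0 : Fin.succAbove (2 : Fin 3) 0 = 0 := rfl
    have h1 : Fin.succAbove (2 : Fin 3) 1 = 1 := rfl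
    simp only [he, hB, mem_preimage, MeasurableEquiv.piFinSuccAbove_apply,
      Fin.insertNthEquiv_symm_apply, mem_prod, mem_Ioo, Metric.mem_ball, dist_pi_lt_iff hr,
      Fin.forall_fin_two, Fin.removeNth_apply, h0, h1, Matrix.cons_val_zero, Matrix.cons_val_one,
      mem_setOf_eq]
    tauto
  have h2 : IntegrableOn (fun z : ℝ × (Fin 2 → ℝ) => 1 / z.1 ^ 3) (Ioo 0 δ ×ˢ B) := by
    refine ((volume_preserving_piFinSuccAbove (fun _ : Fin 3 => ℝ) 2).integrableOn_comp_preimage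
      e.measurableEmbedding).1 ?_
    rw [hpre]
    exact hbox
  rw [IntegrableOn, Measure.volume_eq_prod, ← Measure.prod_restrict] at h2
  have h3 := h2.prod_left_ae
  have hne : (volume.restrict B : Measure (Fin 2 → ℝ)) ≠ 0 := by
    rw [Ne, Measure.restrict_eq_zero]
    exact (Metric.measure_ball_pos volume _ hr).ne'
  haveI : (ae (volume.restrict B : Measure (Fin 2 → ℝ))).NeBot := ae_neBot.2 hne
  obtain ⟨q, hq⟩ := h3.exists
  exact floorDiv_not_integrableOn_inv_cube hδ hq

/-- OFF A SIMPLE ZERO OF ONE TRACE: if at a floor point `n` every floor trace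
`gⱼ(n) = L j 0 * |n|² + L j 1 * n₀ + L j 2 * n₁ + L j 3` is positive, except possibly one, `gᵢ`,
which vanishes with non-zero gradient `∇gᵢ(n) = (2 L i 0 n₀ + L i 1, 2 L i 0 n₁ + L i 2)`, then
at some floor point ALL traces are positive: move off `n` along the gradient,
`gᵢ(n + s ∇gᵢ(n)) = s |∇gᵢ(n)|² (1 + L i 0 s) > 0` for small `s > 0`, while the other traces stay
positive by continuity. [folklore] -/
theorem floorDiv_exists_allPos {k : ℕ} (L : Fin k → Fin 4 → ℝ) (n : Fin 2 → ℝ)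
    (hn : ∀ i, 0 < L i 0 * (n 0 ^ 2 + n 1 ^ 2) + L i 1 * n 0 + L i 2 * n 1 + L i 3 ∨
        (L i 0 * (n 0 ^ 2 + n 1 ^ 2) + L i 1 * n 0 + L i 2 * n 1 + L i 3 = 0 ∧
          (2 * L i 0 * n 0 + L i 1 ≠ 0 ∨ 2 * L i 0 * n 1 + L i 2 ≠ 0) ∧
          ∀ j, j ≠ i → 0 < L j 0 * (n 0 ^ 2 + n 1 ^ 2) + L j 1 * n 0 + L j 2 * n 1 + L j 3)) :
    ∃ x y : ℝ, ∀ i, 0 < L i 0 * (x ^ 2 + y ^ 2) + L i 1 * x + L i 2 * y + L i 3 := by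
  by_cases hall : ∀ i, 0 < L i 0 * (n 0 ^ 2 + n 1 ^ 2) + L i 1 * n 0 + L i 2 * n 1 + L i 3
  · exact ⟨n 0, n 1, hall⟩
  push Not at hall
  obtain ⟨i, hi⟩ := hall
  obtain ⟨hi0, hgrad, hothers⟩ := (hn i).resolve_left (not_lt.2 hi)
  -- the gradient `(v0, v1)` of the vanishing trace at `n`
  obtain ⟨v0, hv0⟩ : ∃ v0 : ℝ, v0 = 2 * L i 0 * n 0 + L i 1 := ⟨_, rfl⟩
  obtain ⟨v1, hv1⟩ : ∃ v1 : ℝ, v1 = 2 * L i 0 * n 1 + L i 2 := ⟨_, rfl⟩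
  rw [← hv0, ← hv1] at hgrad
  have hv : 0 < v0 ^ 2 + v1 ^ 2 := by
    rcases hgrad with h | h <;> positivity
  -- every trace is positive at `n + s (v0, v1)` for all small `s > 0`
  have key : ∀ j, ∀ᶠ s in 𝓝[>] (0 : ℝ),
      0 < L j 0 * ((n 0 + s * v0) ^ 2 + (n 1 + s * v1) ^ 2) + L j 1 * (n 0 + s * v0) +
        L j 2 * (n 1 + s * v1) + L j 3 := by
    intro j
    by_cases hji : j = i
    · subst hji
      have h2 : ∀ᶠ s in 𝓝 (0 : ℝ), 0 < 1 + L j 0 * s := by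
        have hc : Continuous fun s : ℝ => 1 + L j 0 * s := by fun_prop
        exact continuousAt_const.eventually_lt (hc.continuousAt (x := 0)) (by norm_num)
      filter_upwards [self_mem_nhdsWithin, eventually_nhdsWithin_of_eventually_nhds h2]
        with s hs hs2
      have hid : L j 0 * ((n 0 + s * v0) ^ 2 + (n 1 + s * v1) ^ 2) + L j 1 * (n 0 + s * v0) +
          L j 2 * (n 1 + s * v1) + L j 3 = s * (v0 ^ 2 + v1 ^ 2) * (1 + L j 0 * s) := by
        linear_combination hi0 - (s * v0) * hv0 - (s * v1) * hv1
      rw [hid]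
      exact mul_pos (mul_pos (mem_Ioi.1 hs) hv) hs2
    · have hc : Continuous fun s : ℝ =>
          L j 0 * ((n 0 + s * v0) ^ 2 + (n 1 + s * v1) ^ 2) + L j 1 * (n 0 + s * v0) +
            L j 2 * (n 1 + s * v1) + L j 3 := by
        fun_prop
      have h0 : (0 : ℝ) < L j 0 * ((n 0 + 0 * v0) ^ 2 + (n 1 + 0 * v1) ^ 2) +
          L j 1 * (n 0 + 0 * v0) + L j 2 * (n 1 + 0 * v1) + L j 3 := by
        simpa using hothers j hji
      exact eventually_nhdsWithin_of_eventually_nhds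
        (continuousAt_const.eventually_lt (hc.continuousAt (x := 0)) h0)
  obtain ⟨s, hs⟩ := (eventually_all.2 key).exists
  exact ⟨n 0 + s * v0, n 1 + s * v1, hs⟩

/-- NEAR A FLOOR POINT WITH ALL TRACES POSITIVE every 3-D constraint
`L i 0 * |p|² + L i 1 * p 0 + L i 2 * p 1 + L i 3` stays positive on a whole sup-metric box
`(square of half-side ρ) × (−ρ, ρ)` (continuity of finitely many polynomials). [folklore] -/
theorem floorDiv_exists_box {k : ℕ} (L : Fin k → Fin 4 → ℝ) {x y : ℝ}
    (hq : ∀ i, 0 < L i 0 * (x ^ 2 + y ^ 2) + L i 1 * x + L i 2 * y + L i 3) :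
    ∃ ρ : ℝ, 0 < ρ ∧ ∀ p : Fin 3 → ℝ, dist (p 0) x < ρ → dist (p 1) y < ρ → |p 2| < ρ →
      ∀ i, 0 < L i 0 * (p 0 ^ 2 + p 1 ^ 2 + p 2 ^ 2) + L i 1 * p 0 + L i 2 * p 1 + L i 3 := by
  obtain ⟨c, hc⟩ : ∃ c : Fin 3 → ℝ, c = ![x, y, 0] := ⟨_, rfl⟩
  have hev : ∀ᶠ p in 𝓝 c, ∀ i,
      0 < L i 0 * (p 0 ^ 2 + p 1 ^ 2 + p 2 ^ 2) + L i 1 * p 0 + L i 2 * p 1 + L i 3 := by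
    refine eventually_all.2 fun i => ?_
    have hcont : Continuous fun p : Fin 3 → ℝ =>
        L i 0 * (p 0 ^ 2 + p 1 ^ 2 + p 2 ^ 2) + L i 1 * p 0 + L i 2 * p 1 + L i 3 := by
      fun_prop
    have h0 : (0 : ℝ) <
        L i 0 * (c 0 ^ 2 + c 1 ^ 2 + c 2 ^ 2) + L i 1 * c 0 + L i 2 * c 1 + L i 3 := by
      simpa [hc] using hq i
    exact continuousAt_const.eventually_lt (hcont.continuousAt (x := c)) h0
  obtain ⟨ρ, hρ, hball⟩ := Metric.eventually_nhds_iff.1 hev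
  refine ⟨ρ, hρ, fun p h0 h1 h2 => hball ?_⟩
  rw [dist_pi_lt_iff hρ]
  intro b
  fin_cases b
  · simpa [hc] using h0
  · simpa [hc] using h1
  · simpa [hc, Real.dist_eq] using h2

/-- STUB `stub_floorDivergence` (v5): if at a point `n` of the boundary plane at most one floor
trace vanishes (then with non-zero gradient) and all the others are positive, the polytope
`P = {t > 0} ∩ ⋂ᵢ {0 < L i • Ql p}` contains a box `(square) × (0, ρ)` and `∫ t⁻³ = ∞` on it: no
finite-volume polytope touches the floor away from the floor candidates. [folklore] -/
theorem stub_floorDivergence :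
    ∀ (Ql : (Fin 3 → ℝ) → Fin 4 → ℝ), (∀ p, Ql p = ![p 0 ^ 2 + p 1 ^ 2 + p 2 ^ 2, p 0, p 1, 1]) →
    ∀ (k : ℕ) (L : Fin k → Fin 4 → ℝ) (P : Set (Fin 3 → ℝ)),
      P = {p | 0 < p 2 ∧ ∀ i, 0 < ∑ c, L i c * Ql p c} →
    ∀ (n : Fin 2 → ℝ),
      (∀ i, 0 < L i 0 * (n 0 ^ 2 + n 1 ^ 2) + L i 1 * n 0 + L i 2 * n 1 + L i 3 ∨
        (L i 0 * (n 0 ^ 2 + n 1 ^ 2) + L i 1 * n 0 + L i 2 * n 1 + L i 3 = 0 ∧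
          (2 * L i 0 * n 0 + L i 1 ≠ 0 ∨ 2 * L i 0 * n 1 + L i 2 ≠ 0) ∧
          ∀ j, j ≠ i → 0 < L j 0 * (n 0 ^ 2 + n 1 ^ 2) + L j 1 * n 0 + L j 2 * n 1 + L j 3)) →
      ¬ IntegrableOn (fun p : Fin 3 → ℝ => 1 / p 2 ^ 3) P := by
  intro Ql hQl k L P hP n hn
  -- the constraints in closed form: trace plus `L i 0 * t²`
  have hF : ∀ i (p : Fin 3 → ℝ), ∑ c, L i c * Ql p c =
      L i 0 * (p 0 ^ 2 + p 1 ^ 2 + p 2 ^ 2) + L i 1 * p 0 + L i 2 * p 1 + L i 3 := by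
    intro i p
    rw [hQl, Fin.sum_univ_four]
    simp
  -- a floor point with all traces positive, and a box above a square around it inside `P`
  obtain ⟨x, y, hq⟩ := floorDiv_exists_allPos L n hn
  obtain ⟨ρ, hρ, hbox⟩ := floorDiv_exists_box L hq
  refine floorDiv_not_integrableOn_of_box (x := x) (y := y) hρ hρ (fun p hp => ?_)
  obtain ⟨h0, h1, h2, h3⟩ := hp
  rw [hP]
  refine ⟨h2, fun i => ?_⟩
  rw [hF]
  exact hbox p h0 h1 (abs_lt.2 ⟨by linarith, h3⟩) i

end Summit.KontsevichZagierPeriods.HyperbolicBloch.OffTetraSectorKernel
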